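import Mathlib.Analysis.Fourier.Inversion
import Mathlib.Analysis.PSeries
import Literature.NumberTheory.LFunctions.AlternativeHypothesisFormFactorProofs
import Literature.NumberTheory.LFunctions.MontgomeryTheoremGoldstonMontgomery
import Literature.NumberTheory.LFunctions.WienerIkeharaKernel
import HarnessLib

/-!
# BGSTB 2025, Corollary 4 (i): `𝒞 = 1` under RH and Montgomery's conjecture — proved,
# with its input, Goldston's uniform window bound `∫_a^{a+1} F ≪ 1` (from `F ≥ 0` and a pair count)

Topic `Literature/NumberTheory/LFunctions` (namespace `Literature.NumberTheory.LFunctions`). PROOF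
LAYER for conjunct (i) of the claim `bgstb2025_corollary4` of `AlternativeHypothesisFormFactor.lean`
(cell `rh-crit/ah`, C5, seat t5); theorems only, no definitions, no named facts. LABEL: **NOT
RH-BEARING** — Corollary 4 (i) is a CONDITIONAL on RH and on Montgomery's (unproved) prediction
`F(α) ∼ 1` uniformly on bounded ranges `1 ≤ α ≤ U`; both stay hypotheses; nothing here bears on the
truth of RH or of Montgomery's conjecture.

## What the source prints (held TeX text `paper:arxiv-2508.10857`, chunks p0008, p0016)

S. A. C. Baluyot, D. A. Goldston, A. I. Suriajaya, C. L. Turnage-Butterbaugh, *The Alternative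
Hypothesis for zeros of the Riemann zeta-function*, arXiv:2508.10857 (2025; UNREFEREED, D-0012):

* **Corollary 4 (i)** (p0008:L46–L52): with `𝒞 = lim_{T→∞} ∫_1^∞ F(α) α^{-2} dα` (Goldston 1987,
  "if this limit exists"): "Assuming the Riemann Hypothesis and Montgomery's [prediction] that
  `F(α) ∼ 1` for `1 ≤ α ≤ U` for arbitrarily large `U`. Then `𝒞 = 1`."
* **§7, proof** (p0016:L52–L82): "Assuming Montgomery's conjecture, we have for any large `U > 0`,
  `∫_1^∞ F(α)/α² dα = ∫_1^U (1+o(1))/α² dα + ∫_U^∞ F(α)/α² dα`. By [Goldston87], we have uniformly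
  for all `a = a(T)`, `∫_a^{a+1} F(α) dα ≪ 1`. Hence
  `0 ≤ ∫_U^∞ F/α² ≤ ∑_{n=[U]}^∞ n^{-2} ∫_n^{n+1} F ≪ ∑_{n ≥ [U]} n^{-2} ≪ 1/U`, and therefore
  `∫_1^∞ F/α² = 1 + O(U^{-1}) + o(1)`, which upon letting `U = U(T) → ∞` gives … `𝒞 = 1`."

## What is proved

* (`F(α, T) ≥ 0` for `T > 1`, exactly and without RH, is the tree's
  `Montgomery.montgomeryFormFactor_nonneg` (`MontgomeryTheoremGoldstonMontgomery.lean`, landed while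
  this file was written); here only the trivial bound `abs_montgomeryFormFactor_le` is added.)
* `fourier_sinc_sq` — the Fourier pair `𝓕(sinc²(πλ·)) = λ^{-2} max(λ − |·|, 0)` (inversion of the
  tree's `AH.fourier_fejerTest`).
* `exists_integral_formFactor_window_le` — **Goldston's uniform window bound** under RH: `∃ C`, for
  all large `T` and every `c`, `∫_{c−1/2}^{c+1/2} F(α, T) dα ≤ C` (the input "[Goldston87]" of §7;
  proof: `F ≥ 0`, the window is dominated by `(π²/4) sinc²(πλ(α − c))`, whose pair-sum side —
  tree `AH.sum_fourier_pairSpacing_eq_integral` — is supported on `|((γ−γ')/2π) log T| ≤ λ` and is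
  bounded by the tree's pair count `RudnickSarnak.exists_pairCount_window_le`).
* `bgstb2025_corollary4_i` — **Corollary 4 (i)**, verbatim the first conjunct of
  `bgstb2025_corollary4`, PROVED along the printed lines (the tail handled as the limit of
  `∫_U^{U+M}`, window by window, with `∑_k (U+k)^{-2} ≤ 2/U`).

The four-part claim `bgstb2025_corollary4` itself stays a CLAIM: parts (ii)–(iv) rest on Theorem 3
(the shape of `F` beyond `|α| ≤ 1` under AH-Pairs), not proved in the tree.

## References

* [BaluyotGoldstonSuriajayaTurnageButterbaugh2025] arXiv:2508.10857, Corollary 4 (p. 8), §7 (p. 16).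
* [Goldston2005] D. A. Goldston, *Notes on pair correlation of zeros and prime numbers*, (4.1), §5.
* [Montgomery1973] H. L. Montgomery, *The pair correlation of zeros of the zeta function*, Theorem.
* D. A. Goldston, *On the function S(T) in the theory of the Riemann zeta-function*, J. Number
  Theory 27 (1987) — the "[Goldston87]" of the source; cited through BGSTB, not read here.
-/

noncomputable section

open Filter Set MeasureTheory Asymptotics
open scoped Real Topology FourierTransform

namespace Literature.NumberTheory.LFunctions

/-! ## §1. The trivial bound for `F(α, T)` (non-negativity is the tree's
`Montgomery.montgomeryFormFactor_nonneg`, `MontgomeryTheoremGoldstonMontgomery.lean`) -/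

/-- The trivial bound `|F(α, T)| ≤ (2π/(T log T)) · #{pairs}` (`|cos| ≤ 1`, `0 < w ≤ 1`), uniform
in `α`. [cite: Montgomery1973, §1 (1)] -/
theorem abs_montgomeryFormFactor_le (α T : ℝ) :
    |montgomeryFormFactor α T| ≤
      |2 * π / (T * Real.log T)| * ((zeroIndexSet T ×ˢ zeroIndexSet T).card : ℝ) := by
  unfold montgomeryFormFactor
  rw [abs_mul]
  gcongr
  refine (Finset.abs_sum_le_sum_abs _ _).trans ?_
  have : ∀ p ∈ zeroIndexSet T ×ˢ zeroIndexSet T,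
      |Real.cos (α * Real.log T * (zetaOrdinate p.1 - zetaOrdinate p.2)) *
        montgomeryWeight (zetaOrdinate p.1 - zetaOrdinate p.2)| ≤ 1 := fun p _ ↦ by
    rw [abs_mul, abs_of_pos (montgomeryWeight_pos _)]
    exact mul_le_one₀ (Real.abs_cos_le_one _) (montgomeryWeight_pos _).le
      (montgomeryWeight_le_one _)
  exact (Finset.sum_le_sum this).trans (by simp)

/-! ## §2. The Fourier pair (sinc², triangle) on the `α`-side -/

/-- `𝓕 (a ↦ sinc²(πλa)) = (t ↦ λ⁻² max(λ − |t|, 0))` (`λ > 0`): Fourier inversion of the tree's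
`AH.fourier_fejerTest` (`𝓕 (λ⁻² max(λ − |·|, 0)) = sinc²(πλ ·)`), both sides continuous and
integrable. [cite: BaluyotGoldstonSuriajayaTurnageButterbaugh2025, §5 (K-Fejer)] -/
theorem fourier_sinc_sq {lam : ℝ} (hlam : 0 < lam) (t : ℝ) :
    𝓕 (fun a : ℝ ↦ ((Real.sinc (π * lam * a) ^ 2 : ℝ) : ℂ)) t = (AH.fejerTest lam 0 t : ℂ) := by
  set f : ℝ → ℂ := fun v ↦ (AH.fejerTest lam 0 v : ℂ) with hf
  have hFf : 𝓕 f = fun y : ℝ ↦ ((Real.sinc (π * lam * y) ^ 2 : ℝ) : ℂ) := by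
    funext y
    rw [hf, AH.fourier_fejerTest hlam 0 y]
    simp
  have hfc : Continuous f := Complex.continuous_ofReal.comp (AH.continuous_fejerTest lam 0)
  have hfi : Integrable f := (AH.integrable_fejerTest lam 0).ofReal
  have hsinc : Integrable fun y : ℝ ↦ Real.sinc (π * lam * y) ^ 2 := by
    have h := (WienerIkehara.integrable_fejer (l := π * lam) (by positivity)).const_mul
      (1 / (2 * (π * lam)))
    refine h.congr (Eventually.of_forall fun y ↦ ?_)
    have : 2 * (π * lam) ≠ 0 := by positivity
    field_simp
  have hFfi : Integrable (𝓕 f) := by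
    rw [hFf]
    exact hsinc.ofReal
  have hinv := hfc.fourierInv_fourier_eq hfi hFfi
  have h1 : 𝓕 (𝓕 f) t = 𝓕⁻ (𝓕 f) (-t) := by
    rw [Real.fourierInv_eq_fourier_neg, neg_neg]
  rw [← hFf, h1, hinv, hf]
  simp only [AH.fejerTest, sub_zero, abs_neg]

/-- Translating the test function only multiplies its Fourier transform by a phase:
`‖𝓕(a ↦ sinc²(πλ(a − c)))(t)‖ = λ⁻² max(λ − |t|, 0)`. [folklore] -/
private theorem norm_fourier_sinc_sq_sub {lam : ℝ} (hlam : 0 < lam) (c t : ℝ) :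
    ‖𝓕 (fun a : ℝ ↦ ((Real.sinc (π * lam * (a - c)) ^ 2 : ℝ) : ℂ)) t‖ = AH.fejerTest lam 0 t := by
  set G : ℝ → ℂ := fun a ↦ ((Real.sinc (π * lam * a) ^ 2 : ℝ) : ℂ) with hG
  have hshift : 𝓕 (fun a : ℝ ↦ ((Real.sinc (π * lam * (a - c)) ^ 2 : ℝ) : ℂ)) t =
      Complex.exp (↑(-2 * π * c * t) * Complex.I) * 𝓕 G t := by
    rw [Real.fourier_real_eq_integral_exp_smul, Real.fourier_real_eq_integral_exp_smul]
    simp only [smul_eq_mul]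
    calc ∫ v : ℝ, Complex.exp (↑(-2 * π * v * t) * Complex.I) *
          ((Real.sinc (π * lam * (v - c)) ^ 2 : ℝ) : ℂ)
        = ∫ u : ℝ, Complex.exp (↑(-2 * π * (u + c) * t) * Complex.I) *
            ((Real.sinc (π * lam * (u + c - c)) ^ 2 : ℝ) : ℂ) :=
          (integral_add_right_eq_self (fun v : ℝ ↦ Complex.exp (↑(-2 * π * v * t) * Complex.I) *
            ((Real.sinc (π * lam * (v - c)) ^ 2 : ℝ) : ℂ)) c).symm
      _ = ∫ u : ℝ, Complex.exp (↑(-2 * π * c * t) * Complex.I) *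
            (Complex.exp (↑(-2 * π * u * t) * Complex.I) * G u) := by
          congr 1
          funext u
          simp only [hG, add_sub_cancel_right]
          rw [show (↑(-2 * π * (u + c) * t) : ℂ) * Complex.I =
              ↑(-2 * π * c * t) * Complex.I + ↑(-2 * π * u * t) * Complex.I by push_cast; ring,
            Complex.exp_add]
          ring
      _ = Complex.exp (↑(-2 * π * c * t) * Complex.I) *
            ∫ u : ℝ, Complex.exp (↑(-2 * π * u * t) * Complex.I) * G u := integral_const_mul _ _
  rw [hshift, norm_mul, Complex.norm_exp_ofReal_mul_I, one_mul, hG, fourier_sinc_sq hlam,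
    Complex.norm_real, Real.norm_eq_abs, abs_of_nonneg (AH.fejerTest_nonneg _ _ _)]

/-- Jordan's inequality squared: `sinc(x)² ≥ 4/π²` for `|x| ≤ π/2`. [folklore] -/
private theorem four_div_pi_sq_le_sinc_sq {x : ℝ} (hx : |x| ≤ π / 2) :
    4 / π ^ 2 ≤ Real.sinc x ^ 2 := by
  wlog h0 : 0 ≤ x generalizing x
  · have h := this (x := -x) (by rwa [abs_neg]) (by linarith [le_of_not_ge h0])
    simpa [Real.sinc_neg] using h
  rcases h0.eq_or_lt with heq | hpos
  · rw [← heq, Real.sinc_zero, one_pow, div_le_one (by positivity)]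
    nlinarith [Real.pi_gt_three]
  · rw [abs_of_pos hpos] at hx
    rw [Real.sinc_of_ne_zero hpos.ne']
    have h1 : 2 / π * x ≤ Real.sin x := Real.mul_le_sin hpos.le hx
    have h2 : 2 / π ≤ Real.sin x / x := by rw [le_div_iff₀ hpos]; linarith
    have h3 : 0 ≤ 2 / π := by positivity
    calc 4 / π ^ 2 = (2 / π) ^ 2 := by ring
      _ ≤ (Real.sin x / x) ^ 2 := pow_le_pow_left₀ h3 h2 2

/-! ## §3. Goldston's uniform bound for `F` on unit windows -/

/-- **`∫_a^{a+1} F(α, T) dα ≪ 1` uniformly in `a`** (assuming RH; Goldston 1987, as quoted in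
BGSTB 2025, §7: "By [Goldston87], we have uniformly for all `a = a(T)`, `∫_a^{a+1} F(α) dα ≪ 1`"):
there is `C` such that for all large `T` and every centre `c`, `∫_{c−1/2}^{c+1/2} F(α, T) dα ≤ C`.
Proof: `F ≥ 0` (`Montgomery.montgomeryFormFactor_nonneg`) and `sinc²(πλ(α − c)) ≥ 4/π²` on the
window
(`λ ≤ 1`), so the window integral is at most `(π²/4) ∫ F(α) sinc²(πλ(α−c)) dα
= (π²/4) (2π/(T log T)) ∑_{γ,γ'} ĝ(((γ−γ')/2π) log T) w(γ−γ')` (tree: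
`AH.sum_fourier_pairSpacing_eq_integral`) with `|ĝ| = λ⁻² max(λ − |·|, 0) ≤ λ⁻¹ 𝟙_{|·|≤λ}`
(`fourier_sinc_sq`), and the number of pairs with `|((γ−γ')/2π) log T| ≤ λ ≤ y₀` is `≪ T log T`
(tree: `RudnickSarnak.exists_pairCount_window_le`, a corollary of Montgomery's theorem).
[cite: BaluyotGoldstonSuriajayaTurnageButterbaugh2025, §7 (proof of Corollary 4)] -/
theorem exists_integral_formFactor_window_le (hRH : RiemannHypothesis) :
    ∃ C : ℝ, ∀ᶠ T : ℝ in atTop, ∀ c : ℝ,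
      ∫ a in (c - 1 / 2)..(c + 1 / 2), montgomeryFormFactor a T ≤ C := by
  obtain ⟨y₀, hy₀, Cw, hwin⟩ := RudnickSarnak.exists_pairCount_window_le hRH
  set lam : ℝ := min y₀ 1 with hlam
  have hlam0 : 0 < lam := lt_min hy₀ one_pos
  have hlam1 : lam ≤ 1 := min_le_right _ _
  have hlamy : lam ≤ y₀ := min_le_left _ _
  refine ⟨π ^ 2 / 4 * (2 * π * Cw / lam), ?_⟩
  filter_upwards [hwin, eventually_gt_atTop (1 : ℝ),
    Real.tendsto_log_atTop.eventually (eventually_ge_atTop (π * y₀))] with T hwinT hT1 hlogT c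
  have hT0 : 0 < T := by linarith
  have hlog : 0 < Real.log T := Real.log_pos hT1
  have hN : 0 < T / (2 * π) * Real.log T := by positivity
  -- the test function `g(a) = sinc²(πλ(a − c))`
  set g : ℝ → ℝ := fun a ↦ Real.sinc (π * lam * (a - c)) ^ 2 with hg
  have hg0 : ∀ a, 0 ≤ g a := fun a ↦ sq_nonneg _
  have hgi : Integrable g := by
    have h := (WienerIkehara.integrable_fejer (l := π * lam) (by positivity)).const_mul
      (1 / (2 * (π * lam)))
    have h' : Integrable fun a : ℝ ↦ Real.sinc (π * lam * a) ^ 2 := by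
      refine h.congr (Eventually.of_forall fun y ↦ ?_)
      have : 2 * (π * lam) ≠ 0 := by positivity
      field_simp
    exact h'.comp_sub_right c
  -- (1) the window is dominated by `(π²/4) ∫ F g`
  have hF0 : ∀ a, 0 ≤ montgomeryFormFactor a T := fun a ↦
    Montgomery.montgomeryFormFactor_nonneg a hT1
  have hFc : Continuous fun a ↦ montgomeryFormFactor a T :=
    RudnickSarnak.continuous_montgomeryFormFactor T
  have hFg_int : Integrable fun a ↦ montgomeryFormFactor a T * g a := by
    refine hgi.bdd_mul (c := |2 * π / (T * Real.log T)| *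
      ((zeroIndexSet T ×ˢ zeroIndexSet T).card : ℝ)) hFc.aestronglyMeasurable
      (Eventually.of_forall fun a ↦ ?_)
    rw [Real.norm_eq_abs]
    exact abs_montgomeryFormFactor_le a T
  have hwin_le : ∀ a ∈ Icc (c - 1 / 2) (c + 1 / 2),
      montgomeryFormFactor a T ≤ π ^ 2 / 4 * (montgomeryFormFactor a T * g a) := by
    intro a ha
    have hx : |π * lam * (a - c)| ≤ π / 2 := by
      rw [abs_mul, abs_of_pos (by positivity : 0 < π * lam)]
      have hac : |a - c| ≤ 1 / 2 := abs_le.mpr ⟨by linarith [ha.1], by linarith [ha.2]⟩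
      calc π * lam * |a - c| ≤ π * 1 * (1 / 2) := by gcongr
        _ = π / 2 := by ring
    have h4 := four_div_pi_sq_le_sinc_sq hx
    have h1 : 1 ≤ π ^ 2 / 4 * g a := by
      have hπ : 0 < π ^ 2 / 4 := by positivity
      calc (1 : ℝ) = π ^ 2 / 4 * (4 / π ^ 2) := by field_simp
        _ ≤ π ^ 2 / 4 * Real.sinc (π * lam * (a - c)) ^ 2 := by gcongr
    calc montgomeryFormFactor a T = montgomeryFormFactor a T * 1 := (mul_one _).symm
      _ ≤ montgomeryFormFactor a T * (π ^ 2 / 4 * g a) :=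
          mul_le_mul_of_nonneg_left h1 (hF0 a)
      _ = π ^ 2 / 4 * (montgomeryFormFactor a T * g a) := by ring
  have hle : (c - 1 / 2 : ℝ) ≤ c + 1 / 2 := by linarith
  have hstep1 : ∫ a in (c - 1 / 2)..(c + 1 / 2), montgomeryFormFactor a T ≤
      π ^ 2 / 4 * ∫ a, montgomeryFormFactor a T * g a := by
    rw [intervalIntegral.integral_of_le hle, ← integral_const_mul]
    calc ∫ a in Ioc (c - 1 / 2) (c + 1 / 2), montgomeryFormFactor a T
        ≤ ∫ a in Ioc (c - 1 / 2) (c + 1 / 2), π ^ 2 / 4 * (montgomeryFormFactor a T * g a) :=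
          setIntegral_mono_on hFc.integrableOn_Ioc (hFg_int.const_mul _).integrableOn
            measurableSet_Ioc fun a ha ↦ hwin_le a (Ioc_subset_Icc_self ha)
      _ ≤ ∫ a, π ^ 2 / 4 * (montgomeryFormFactor a T * g a) :=
          setIntegral_le_integral (hFg_int.const_mul _)
            (Eventually.of_forall fun a ↦ by
              have := hF0 a
              have := hg0 a
              positivity)
  -- (2) `∫ F g ≤ 2π C_w/λ` via the pair sum
  have hid := AH.sum_fourier_pairSpacing_eq_integral g hgi hT1
  have hI0 : 0 ≤ ∫ a, montgomeryFormFactor a T * g a :=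
    integral_nonneg fun a ↦ mul_nonneg (hF0 a) (hg0 a)
  have hnormR : ‖((T / (2 * π) * Real.log T * ∫ a : ℝ, montgomeryFormFactor a T * g a : ℝ) : ℂ)‖ =
      T / (2 * π) * Real.log T * ∫ a, montgomeryFormFactor a T * g a := by
    rw [Complex.norm_real, Real.norm_eq_abs, abs_of_nonneg (mul_nonneg hN.le hI0)]
  have hnormL : ‖∑ p ∈ zeroIndexSet T ×ˢ zeroIndexSet T,
      𝓕 (fun a : ℝ ↦ (g a : ℂ)) (AH.pairSpacing T p) *
        (montgomeryWeight (zetaOrdinate p.1 - zetaOrdinate p.2) : ℂ)‖ ≤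
      lam⁻¹ * (((zeroIndexSet T ×ˢ zeroIndexSet T).filter fun p ↦
          |Real.log T / (2 * π) * (zetaOrdinate p.1 - zetaOrdinate p.2) - 0| ≤ y₀).card : ℝ) := by
    refine (norm_sum_le _ _).trans ?_
    have hterm : ∀ p ∈ zeroIndexSet T ×ˢ zeroIndexSet T,
        ‖𝓕 (fun a : ℝ ↦ (g a : ℂ)) (AH.pairSpacing T p) *
          (montgomeryWeight (zetaOrdinate p.1 - zetaOrdinate p.2) : ℂ)‖ ≤
        if |Real.log T / (2 * π) * (zetaOrdinate p.1 - zetaOrdinate p.2) - 0| ≤ y₀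
          then lam⁻¹ else 0 := by
      intro p _
      rw [norm_mul, Complex.norm_real, Real.norm_eq_abs, abs_of_pos (montgomeryWeight_pos _)]
      have hgF : ‖𝓕 (fun a : ℝ ↦ (g a : ℂ)) (AH.pairSpacing T p)‖ =
          AH.fejerTest lam 0 (AH.pairSpacing T p) := by
        simp only [hg]
        exact norm_fourier_sinc_sq_sub hlam0 c _
      rw [hgF]
      split_ifs with hp
      · calc AH.fejerTest lam 0 (AH.pairSpacing T p) *
            montgomeryWeight (zetaOrdinate p.1 - zetaOrdinate p.2) ≤ lam⁻¹ * 1 :=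
            mul_le_mul (AH.fejerTest_le hlam0 _ _) (montgomeryWeight_le_one _)
              (montgomeryWeight_pos _).le (inv_nonneg.mpr hlam0.le)
          _ = lam⁻¹ := mul_one _
      · rw [sub_zero, ← AH.pairSpacing_eq] at hp
        push Not at hp
        rw [AH.fejerTest_eq_zero (by rw [sub_zero]; exact hlamy.trans hp.le), zero_mul]
    refine (Finset.sum_le_sum hterm).trans ?_
    rw [Finset.sum_ite, Finset.sum_const_zero, add_zero, Finset.sum_const, nsmul_eq_mul, mul_comm]
  have hcount := hwinT 0 (by rw [abs_zero, zero_add, le_div_iff₀ Real.pi_pos]; linarith)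
  have hmain : T / (2 * π) * Real.log T * ∫ a, montgomeryFormFactor a T * g a ≤
      lam⁻¹ * (Cw * (T * Real.log T)) := by
    rw [← hnormR, ← hid]
    exact hnormL.trans (mul_le_mul_of_nonneg_left hcount (inv_nonneg.mpr hlam0.le))
  have hstep2 : ∫ a, montgomeryFormFactor a T * g a ≤ 2 * π * Cw / lam := by
    have h2 : lam⁻¹ * (Cw * (T * Real.log T)) =
        T / (2 * π) * Real.log T * (2 * π * Cw / lam) := by
      field_simp
    rw [h2] at hmain
    exact le_of_mul_le_mul_left hmain hN
  calc ∫ a in (c - 1 / 2)..(c + 1 / 2), montgomeryFormFactor a T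
      ≤ π ^ 2 / 4 * ∫ a, montgomeryFormFactor a T * g a := hstep1
    _ ≤ π ^ 2 / 4 * (2 * π * Cw / lam) := by gcongr

/-! ## §4. Corollary 4 (i): `𝒞 = 1` -/

/-- `∑_{k<M} 1/(U+k)² ≤ 2/U − 2/(U+M) ≤ 2/U` for `U ≥ 1` (telescoping with
`1/(U+k)² ≤ 2/((U+k)(U+k+1))`). [folklore] -/
private theorem sum_one_div_sq_le {U : ℝ} (hU : 1 ≤ U) (M : ℕ) :
    ∑ k ∈ Finset.range M, 1 / (U + k) ^ 2 ≤ 2 / U := by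
  have key : ∀ M : ℕ, ∑ k ∈ Finset.range M, 1 / (U + k) ^ 2 ≤ 2 / U - 2 / (U + M) := by
    intro M
    induction M with
    | zero => simp
    | succ M ih =>
      rw [Finset.sum_range_succ]
      have hUM : 1 ≤ U + M := by
        have : (0 : ℝ) ≤ M := Nat.cast_nonneg M
        linarith
      have hstep : 1 / (U + M) ^ 2 ≤ 2 / (U + M) - 2 / (U + (M + 1 : ℕ)) := by
        push_cast
        rw [div_sub_div _ _ (by positivity) (by positivity), div_le_div_iff₀ (by positivity)
          (by positivity)]
        nlinarith
      linarith
  have h := key M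
  have : 0 ≤ 2 / (U + M) := by positivity
  linarith

/-- `∫_1^U dα/α² = 1 − 1/U` for `U ≥ 1`. [folklore] -/
private theorem integral_one_div_sq {U : ℝ} (hU : 1 ≤ U) :
    ∫ a in (1 : ℝ)..U, 1 / a ^ 2 = 1 - 1 / U := by
  have hderiv : ∀ x ∈ uIcc (1 : ℝ) U, HasDerivAt (fun y : ℝ ↦ -y⁻¹) (1 / x ^ 2) x := by
    intro x hx
    rw [uIcc_of_le hU] at hx
    have hx0 : x ≠ 0 := by linarith [hx.1]
    have h := (hasDerivAt_inv hx0).neg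
    simp only [neg_neg] at h
    rw [one_div]
    exact h
  have hcont : ContinuousOn (fun x : ℝ ↦ 1 / x ^ 2) (uIcc (1 : ℝ) U) := by
    refine continuousOn_const.div (continuousOn_pow 2) fun x hx ↦ ?_
    rw [uIcc_of_le hU] at hx
    exact pow_ne_zero _ (by linarith [hx.1])
  rw [intervalIntegral.integral_eq_sub_of_hasDerivAt hderiv (hcont.intervalIntegrable)]
  rw [inv_one, one_div]
  ring

/-- **BGSTB 2025, Corollary 4 (i) — PROVED.** "Assuming the Riemann Hypothesis and Montgomery's
[prediction] that `F(α) ∼ 1` for `1 ≤ α ≤ U` for arbitrarily large `U`. Then `𝒞 = 1`", where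
`𝒞 = lim_{T→∞} ∫_1^∞ F(α)/α² dα` (Goldston's constant). This is conjunct (i) of the claim
`bgstb2025_corollary4` (AlternativeHypothesisFormFactor.lean), verbatim: Montgomery's hypothesis is
the form UNIFORM on `[1, U]` for every `U`, and the conclusion is that the limit exists and equals
`1`. Printed proof (§7): "`∫_1^∞ F/α² = ∫_1^U (1+o(1))/α² + ∫_U^∞ F/α²`; by [Goldston87]
`∫_a^{a+1} F ≪ 1` uniformly, hence `0 ≤ ∫_U^∞ F/α² ≤ ∑_{n≥[U]} n^{-2} ∫_n^{n+1} F ≪ 1/U`, and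
therefore `∫_1^∞ F/α² = 1 + O(U^{-1}) + o(1)`." Here: `F ≥ 0` (the tree's
`Montgomery.montgomeryFormFactor_nonneg`), the window bound `exists_integral_formFactor_window_le`, `∫_1^U α^{-2} = 1 − 1/U`, and the tail as the
limit of `∫_U^{U+M}` (`intervalIntegral_tendsto_integral_Ioi`) bounded window by window with
`∑_k (U+k)^{-2} ≤ 2/U`. The other conjuncts (ii)–(iv) of `bgstb2025_corollary4` need Theorem 3 and
are not proved here. LABEL: NOT RH-BEARING — a conditional on RH and on Montgomery's (unproved)
uniform pair-correlation prediction, both hypotheses.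
[cite: BaluyotGoldstonSuriajayaTurnageButterbaugh2025, Corollary 4 (i) and §7] -/
theorem bgstb2025_corollary4_i :
    RiemannHypothesis →
    (∀ U : ℝ, 1 ≤ U → ∀ ε : ℝ, 0 < ε → ∀ᶠ T : ℝ in atTop, ∀ α ∈ Icc 1 U,
        |montgomeryFormFactor α T - 1| ≤ ε) →
      Tendsto (fun T : ℝ ↦ ∫ α in Ioi (1 : ℝ), montgomeryFormFactor α T / α ^ 2) atTop (𝓝 1) := by
  intro hRH hMont
  obtain ⟨C, hC⟩ := exists_integral_formFactor_window_le hRH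
  set C' : ℝ := max C 0 with hC'
  have hC'0 : 0 ≤ C' := le_max_right _ _
  refine Metric.tendsto_nhds.mpr fun η hη ↦ ?_
  -- the cut-off `U = N + 1` with `(2C' + 1)/U ≤ η/4`
  obtain ⟨N, hN⟩ := exists_nat_ge ((2 * C' + 1) * (4 / η))
  set U : ℝ := (N : ℝ) + 1 with hU
  have hN0 : (0 : ℝ) ≤ N := Nat.cast_nonneg N
  have hU1 : 1 ≤ U := by linarith
  have hU0 : 0 < U := by linarith
  have hUη : (2 * C' + 1) / U ≤ η / 4 := by
    rw [div_le_iff₀ hU0]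
    have h1 : (2 * C' + 1) * (4 / η) ≤ U := hN.trans (by linarith)
    calc 2 * C' + 1 = (2 * C' + 1) * (4 / η) * (η / 4) := by field_simp
      _ ≤ U * (η / 4) := by gcongr
      _ = η / 4 * U := mul_comm _ _
  filter_upwards [hC, hMont U hU1 (η / 4) (by positivity), eventually_gt_atTop (1 : ℝ)]
    with T hCT hεT hT1
  -- abbreviations and basic facts at this `T`
  set F : ℝ → ℝ := fun α ↦ montgomeryFormFactor α T with hF
  have hF0 : ∀ a, 0 ≤ F a := fun a ↦ Montgomery.montgomeryFormFactor_nonneg a hT1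
  have hFc : Continuous F := RudnickSarnak.continuous_montgomeryFormFactor T
  set B : ℝ := |2 * π / (T * Real.log T)| * ((zeroIndexSet T ×ˢ zeroIndexSet T).card : ℝ) with hB
  have hFB : ∀ a, |F a| ≤ B := fun a ↦ abs_montgomeryFormFactor_le a T
  have hcontOn : ContinuousOn (fun α ↦ F α / α ^ 2) (Ioi 0) :=
    hFc.continuousOn.div (continuousOn_pow 2) fun x hx ↦ pow_ne_zero _ (ne_of_gt hx)
  -- integrability of `F/α²` on `(1, ∞)`
  have hint1 : IntegrableOn (fun α ↦ F α / α ^ 2) (Ioi (1 : ℝ)) := by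
    have hrpow : IntegrableOn (fun α : ℝ ↦ B * α ^ (-2 : ℝ)) (Ioi (1 : ℝ)) :=
      (integrableOn_Ioi_rpow_of_lt (by norm_num : (-2 : ℝ) < -1) one_pos).const_mul B
    refine hrpow.mono' ((hcontOn.mono (Ioi_subset_Ioi zero_le_one)).aestronglyMeasurable
      measurableSet_Ioi) ?_
    filter_upwards [self_mem_ae_restrict measurableSet_Ioi] with α hα
    have hα0 : 0 < α := lt_trans one_pos hα
    rw [Real.norm_eq_abs, abs_div, abs_of_pos (pow_pos hα0 2), Real.rpow_neg hα0.le,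
      Real.rpow_two, div_eq_mul_inv]
    exact mul_le_mul_of_nonneg_right (hFB α) (inv_nonneg.mpr (sq_nonneg α))
  -- split `(1, ∞) = (1, U] ∪ (U, ∞)`
  have hsplit : ∫ α in Ioi (1 : ℝ), F α / α ^ 2 =
      (∫ α in Ioc (1 : ℝ) U, F α / α ^ 2) + ∫ α in Ioi U, F α / α ^ 2 := by
    rw [← setIntegral_union (s := Ioc (1 : ℝ) U) (t := Ioi U) Ioc_disjoint_Ioi_same
      measurableSet_Ioi (hint1.mono_set Ioc_subset_Ioi_self)
      (hint1.mono_set (Ioi_subset_Ioi hU1)), Ioc_union_Ioi_eq_Ioi hU1]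
  -- (a) the main part: `|∫_{(1,U]} F/α² − (1 − 1/U)| ≤ η/4`
  have hinvsq_int : IntervalIntegrable (fun α : ℝ ↦ 1 / α ^ 2) volume 1 U := by
    refine (continuousOn_const.div (continuousOn_pow 2) fun x hx ↦ ?_).intervalIntegrable
    rw [uIcc_of_le hU1] at hx
    exact pow_ne_zero _ (by linarith [hx.1])
  have hmainI : IntegrableOn (fun α ↦ F α / α ^ 2) (Ioc (1 : ℝ) U) :=
    hint1.mono_set Ioc_subset_Ioi_self
  have hinvI : IntegrableOn (fun α : ℝ ↦ 1 / α ^ 2) (Ioc (1 : ℝ) U) :=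
    (intervalIntegrable_iff_integrableOn_Ioc_of_le hU1).mp hinvsq_int
  have hmain : |(∫ α in Ioc (1 : ℝ) U, F α / α ^ 2) - (1 - 1 / U)| ≤ η / 4 := by
    have h1 : (1 : ℝ) - 1 / U = ∫ α in Ioc (1 : ℝ) U, 1 / α ^ 2 := by
      rw [← integral_one_div_sq hU1, intervalIntegral.integral_of_le hU1]
    rw [h1, ← integral_sub hmainI hinvI]
    have h2 : ∀ᵐ α ∂(volume.restrict (Ioc (1 : ℝ) U)),
        ‖F α / α ^ 2 - 1 / α ^ 2‖ ≤ η / 4 * (1 / α ^ 2) := by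
      filter_upwards [self_mem_ae_restrict measurableSet_Ioc] with α hα
      have hα0 : 0 < α := lt_trans one_pos hα.1
      have hb := hεT α ⟨hα.1.le, hα.2⟩
      rw [Real.norm_eq_abs, show F α / α ^ 2 - 1 / α ^ 2 = (F α - 1) / α ^ 2 by ring, abs_div,
        abs_of_pos (pow_pos hα0 2), show η / 4 * (1 / α ^ 2) = η / 4 / α ^ 2 by ring]
      exact div_le_div_of_nonneg_right hb (pow_pos hα0 2).le
    have h3 := norm_integral_le_of_norm_le (hinvI.const_mul (η / 4)) h2
    rw [Real.norm_eq_abs] at h3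
    refine h3.trans ?_
    rw [integral_const_mul, ← h1]
    have : 0 ≤ 1 / U := by positivity
    have : 1 - 1 / U ≤ 1 := by linarith
    calc η / 4 * (1 - 1 / U) ≤ η / 4 * 1 := by gcongr
      _ = η / 4 := mul_one _
  -- (b) the tail: `0 ≤ ∫_{(U,∞)} F/α² ≤ 2C'/U`
  have htailI : IntegrableOn (fun α ↦ F α / α ^ 2) (Ioi U) := hint1.mono_set (Ioi_subset_Ioi hU1)
  have htail0 : 0 ≤ ∫ α in Ioi U, F α / α ^ 2 :=
    setIntegral_nonneg measurableSet_Ioi fun α _ ↦ div_nonneg (hF0 α) (sq_nonneg α)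
  have hwindow : ∀ n : ℕ, ∫ a in (U + n)..(U + n + 1), F a / a ^ 2 ≤ C' / (U + n) ^ 2 := by
    intro n
    have hUn : 0 < U + n := by positivity
    have hcI : ∀ f : ℝ → ℝ, ContinuousOn f (Icc (U + n) (U + n + 1)) →
        IntervalIntegrable f volume (U + n) (U + n + 1) := fun f hf ↦ by
      refine (hf.mono ?_).intervalIntegrable
      rw [uIcc_of_le (by linarith)]
    have hc1 : ContinuousOn (fun a ↦ F a / a ^ 2) (Icc (U + n) (U + n + 1)) :=
      hcontOn.mono fun a ha ↦ lt_of_lt_of_le hUn ha.1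
    have hc2 : ContinuousOn (fun a ↦ F a / (U + n) ^ 2) (Icc (U + n) (U + n + 1)) :=
      (hFc.div_const _).continuousOn
    have h1 : ∫ a in (U + n)..(U + n + 1), F a / a ^ 2 ≤
        ∫ a in (U + n)..(U + n + 1), F a / (U + n) ^ 2 := by
      refine intervalIntegral.integral_mono_on (by linarith) (hcI _ hc1) (hcI _ hc2)
        fun a ha ↦ ?_
      exact div_le_div_of_nonneg_left (hF0 a) (pow_pos hUn 2) (pow_le_pow_left₀ hUn.le ha.1 2)
    have h2 : ∫ a in (U + n)..(U + n + 1), F a ≤ C' := by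
      have h := hCT (U + n + 1 / 2)
      rw [show U + n + 1 / 2 - 1 / 2 = U + n by ring,
        show U + n + 1 / 2 + 1 / 2 = U + n + 1 by ring] at h
      exact h.trans (le_max_left _ _)
    calc ∫ a in (U + n)..(U + n + 1), F a / a ^ 2
        ≤ ∫ a in (U + n)..(U + n + 1), F a / (U + n) ^ 2 := h1
      _ = (∫ a in (U + n)..(U + n + 1), F a) / (U + n) ^ 2 :=
          intervalIntegral.integral_div _ _
      _ ≤ C' / (U + n) ^ 2 := div_le_div_of_nonneg_right h2 (pow_pos hUn 2).le
  have hpartial : ∀ M : ℕ, ∫ a in U..(U + M), F a / a ^ 2 ≤ 2 * C' / U := by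
    intro M
    have hint : ∀ k < M, IntervalIntegrable (fun a ↦ F a / a ^ 2) volume
        (U + (k : ℕ)) (U + ((k + 1 : ℕ) : ℝ)) := by
      intro k _
      have hUk : 0 < U + k := by positivity
      have hc : ContinuousOn (fun a ↦ F a / a ^ 2)
          (uIcc (U + (k : ℕ)) (U + ((k + 1 : ℕ) : ℝ))) := by
        refine hcontOn.mono fun a ha ↦ ?_
        rw [uIcc_of_le (by push_cast; linarith)] at ha
        exact lt_of_lt_of_le hUk ha.1
      exact hc.intervalIntegrable
    have hsum := intervalIntegral.sum_integral_adjacent_intervals hint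
    simp only [Nat.cast_zero, add_zero] at hsum
    rw [← hsum]
    calc ∑ k ∈ Finset.range M, ∫ a in (U + (k : ℕ))..(U + ((k + 1 : ℕ) : ℝ)), F a / a ^ 2
        ≤ ∑ k ∈ Finset.range M, C' / (U + k) ^ 2 := by
          refine Finset.sum_le_sum fun k _ ↦ ?_
          have h := hwindow k
          rwa [show (U + (k : ℕ) : ℝ) + 1 = U + ((k + 1 : ℕ) : ℝ) by push_cast; ring] at h
      _ = C' * ∑ k ∈ Finset.range M, 1 / (U + k) ^ 2 := by
          rw [Finset.mul_sum]
          refine Finset.sum_congr rfl fun k _ ↦ ?_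
          ring
      _ ≤ C' * (2 / U) := by gcongr; exact sum_one_div_sq_le hU1 M
      _ = 2 * C' / U := by ring
  have hlim : Tendsto (fun M : ℕ ↦ ∫ a in U..(U + M), F a / a ^ 2) atTop
      (𝓝 (∫ a in Ioi U, F a / a ^ 2)) :=
    intervalIntegral_tendsto_integral_Ioi U htailI
      (tendsto_atTop_add_const_left _ _ tendsto_natCast_atTop_atTop)
  have htail : ∫ α in Ioi U, F α / α ^ 2 ≤ 2 * C' / U := le_of_tendsto' hlim hpartial
  -- (c) assemble
  rw [Real.dist_eq, hsplit]
  have hU' : 0 ≤ 1 / U := by positivity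
  have h1U : 1 / U ≤ (2 * C' + 1) / U := by gcongr; linarith
  have htail' : 2 * C' / U ≤ (2 * C' + 1) / U := by gcongr; linarith
  calc |(∫ α in Ioc (1 : ℝ) U, F α / α ^ 2) + (∫ α in Ioi U, F α / α ^ 2) - 1|
      = |((∫ α in Ioc (1 : ℝ) U, F α / α ^ 2) - (1 - 1 / U)) +
          ((∫ α in Ioi U, F α / α ^ 2) - 1 / U)| := by ring_nf
    _ ≤ |(∫ α in Ioc (1 : ℝ) U, F α / α ^ 2) - (1 - 1 / U)| +
          |(∫ α in Ioi U, F α / α ^ 2) - 1 / U| := abs_add_le _ _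
    _ ≤ η / 4 + (2 * C' + 1) / U := by
        refine add_le_add hmain ?_
        rw [abs_le]
        constructor <;> linarith
    _ ≤ η / 4 + η / 4 := by linarith
    _ < η := by linarith

end Literature.NumberTheory.LFunctions

end
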